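import Summits.CriticalPhenomena.SAWScalingLimit.Theses.SAWRestrictionRigidity
import Literature.Probability.RandomPlanarGeometry.ChordalRestrictionMarkov
import Literature.Probability.RandomPlanarGeometry.ChordalReversibility
import Literature.Probability.RandomPlanarGeometry.LatticeSimilarityCovariance
import Literature.Probability.RandomPlanarGeometry.RadoContinuity

/-!
# `Rigidity` (stmt-CriticalPhenomena-1368) as typed is false modulo `NonRadoAxiomsFamily` — negative lemma (lead c4 of line `registered`, 2026-08-17)

Target: `Summits/CriticalPhenomena/SAWScalingLimit/Theorems/Rigidity/Negative/RigidityFalseOfNonRadoAxiomsFamily.lean`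
(`--kind proof --negative-modulo NonRadoAxiomsFamily --supports stmt-CriticalPhenomena-1368`).

The crux `Rigidity` of routes SAWRestrictionRigidity (r2) / SAWZoomRigidity (r3) asks that EVERY chordal
family with the seven lattice-exact axioms (two-sided restriction, restriction-coupled Markov kernel,
reversal, covariance under `z ↦ r iᵏ z + w` and under conjugation, simple boundary-avoiding curves) be
conformally covariant — with NO continuity of `D ↦ P D` assumed (route design point (c)). Its
conclusion, however, already implies Radó continuity in the domain (tree theorem
`ChordalFamily.IsConformallyCovariant.isRadoContinuous_of_isChordal`, RadoContinuity.lean). Hence the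
typed crux is refuted by any family with the seven axioms that is NOT Radó-continuous:
`Rigidity_false_of_NonRadoAxiomsFamily : NonRadoAxiomsFamily → ¬ Rigidity`.

`NonRadoAxiomsFamily` is NOT constructible in the tree and is open on paper: every candidate (the
domain-keyed conformal structures of crux idea `Cruxes/Rigidity/Ideas/texture-keyed-modulus.md`,
referee credence ≈ 0.4) needs (a) the chordal SLE(8/3) family as a typed restriction–Markov–reversible
object (no such theorem exists in the tree for any non-degenerate family) and (b) an almost-sure,
modification-invariant recognisability of the law type of SLE(8/3)-like slits at every closed-set
hitting time (`Cruxes/Rigidity/AUDIT-c4.md` §3 shows (b) is NECESSARY for every keyed counterexample: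
restriction is rigid only on content-bearing pairs, and explore–reverse–explore makes both marks
curve-generated). So this is the `--negative-modulo` lane: no verdict change on the item, H filed as a
construction. Two consecutive line leads (c3, c4) classify the item as MISSTATED and recommend the
repair C′ = the seven axioms + `ChordalFamily.IsRadoContinuous` (conclusion of item
stmt-CriticalPhenomena-7305) ⇒ conformal covariance (`Cruxes/Rigidity/Repair.lean`, with the repaired
deciding theorem `closesC` checked); C′ is immune to `NonRadoAxiomsFamily` by construction, and the
kernel-checked decomposition `Rigidity ↔ C′ ∧ (axioms ⇒ Radó)` is
`Theorems/SAWRestrictionRigidityRigidityIffRepairAndRado.lean`.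
-/

namespace Summit.CriticalPhenomena.SAWScalingLimit.Theorems.Rigidity.Negative

open MeasureTheory
open Literature.Probability.RandomPlanarGeometry

/-- **Hypothesis `NonRadoAxiomsFamily` (NOT constructible in the tree; filed `--negative-modulo`).** There is a chordal family on Dobrushin domains with the seven lattice-exact axioms of crux `Rigidity` (in the tree's packaged vocabulary, each definitionally the inlined clause: chordal, two-sided restriction `IsRestriction`, a restriction-coupled domain-Markov kernel `IsRestrictionMarkov`, reversibility `IsReversible`, covariance under `z ↦ r iᵏ z + w` and under complex conjugation `IsLatticeSimilarityCovariant`, carried by simple curves meeting `∂D` only at the marks `IsCarriedBySimpleCurves`) which is NOT Radó-continuous in the domain (`ChordalFamily.IsRadoContinuous`). Candidates: domain-keyed conformal structures propagated along the Markov chain by the fine texture of explored tips (crux idea `Ideas/texture-keyed-modulus.md`); every such construction needs the SLE(8/3) restriction–Markov package and a hitting-time tip-recognition theorem (`AUDIT-c4.md` §3), neither available. -/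
def NonRadoAxiomsFamily : Prop :=
  ∃ P : Literature.Probability.RandomPlanarGeometry.ChordalFamily, P.IsChordal ∧ P.IsRestriction ∧ P.IsRestrictionMarkov ∧ P.IsReversible ∧
    P.IsLatticeSimilarityCovariant ∧ P.IsCarriedBySimpleCurves ∧ ¬ P.IsRadoContinuous

/-- **Negative lemma modulo `NonRadoAxiomsFamily`: the crux `Rigidity` AS TYPED (no continuity in the domain) is false as soon as one family with its seven axioms fails Radó continuity** — because the crux's conclusion, conformal covariance, implies Radó continuity for chordal families (`IsConformallyCovariant.isRadoContinuous_of_isChordal`: transport along `Φₙ → Φ` and dominated convergence on the compact traces). Classification: MISSTATED (over-specified by omitting a regularity clause its conclusion implies); repair C′ = add `P.IsRadoContinuous` as a hypothesis (`Cruxes/Rigidity/Repair.lean`), which this witness class misses by definition. [folklore] -/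
theorem Rigidity_false_of_NonRadoAxiomsFamily (hH : NonRadoAxiomsFamily) :
    ¬ Summit.CriticalPhenomena.SAWScalingLimit.Theses.SAWRestrictionRigidity.Rigidity := by
  intro hR
  obtain ⟨P, hch, hres, hRM, hrev, hLS, hS, hnot⟩ := hH
  exact hnot ((hR P hch hres hRM hrev hLS.1 hLS.2 hS).isRadoContinuous_of_isChordal hch)

end Summit.CriticalPhenomena.SAWScalingLimit.Theorems.Rigidity.Negative
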